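import Literature.Probability.Percolation.ZdFrontierTipCatch
import Literature.Probability.Percolation.ZdLowestFrontierFeet
import HarnessLib

/-!
# The event "the frontier of a crossing cluster is `S`": locality without the Jordan curve theorem

Topic `Literature/Probability/Percolation`; bond percolation on `ℤ² = Site 2`. DEFINITIONS with
bodies and their structural theorems (no named fact).  A brick of the EXTERNAL per-scale lemma of
Kesten's arm-separation theorem for four alternating arms of bond percolation on `ℤ²` (H. Kesten,
CMP 109 (1987), §2, Lemma 4; P. Nolin, EJP 13 (2008), §4.4, Lemma 15 [arXiv 0711.4948: Lemma 14,
p. 11]: "The event `E_u := {t ≥ u and c_v = c̃_v …}` is independent from the status of the sites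
above `c̃_u`. Hence, if we condition on `E_u`, percolation there remains unbiased and we can use the
RSW theorem"), in the cluster–frontier form used for ALTERNATING colours (one colour at a time,
no sequence of crossings, no stopping sets): the objects are the open left–right crossing
CLUSTERS of the rectangle `R = [0,M] × [0,N]`, each carries its FRONTIER — the lowest open
left–right crossing of `R` in the configuration consisting of the cluster alone
(`ZdLowestFrontier.lean`: `LowPath`, the low edges `IsLowEdge`) — and the union bound runs over
the possible frontiers `S` (finite sets of edges) of the events

  `E_S = frontierEvent M N S = {ω | S ⊆ ω and the low edges of the cluster of S in (R, ω) are exactly S}`.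

The point of this file is the LOCALITY of `E_S` (`determinedBy_frontierEvent`): `E_S` is determined
by the pairs `belowPairs M N S` = the edges bounding a face of `belowFaces M N S`, the dual region
below `S` — so that events read on the complementary ("fresh") pairs are independent of `E_S`
(`bondPercolation_real_inter_of_disjoint`), which replaces Nolin's conditioning on `E_u`.

**No Jordan curve theorem is used.**  The geometry "below / above the path `S`" is, by
definition, the frontier theory of the configuration `↑S` itself: `belowFaces M N S :=
dualBelowR M N ↑S` (the faces of `R*` flooded from the bottom face row without crossing `S`),
"above `S`" `:= IsAboveFace M N ↑S`, and `S` is a FRONTIER SET when it is its own set of low edges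
(`IsFrontierSet`).  Everything follows from two monotonicity remarks — opening edges shrinks the
flooded region (`dualBelowR_anti`) and enlarges the region above (`IsAboveFace.mono`) — and from
the propagation of "above" across arbitrary steps off the flooded region (`IsAboveFace.of_adj`),
which forces every passage from a non-above face to an above face to happen across a LOW edge:

* `LowPath.not_mem_belowFaces_of_isAboveFace`, `LowPath.isFrontierSet_edges` — the edge set of
  the lowest crossing of ANY lattice configuration `ω` (with a crossing) is a frontier set, the
  faces above for `ω` are above for `↑S`, the flooded faces of `ω` are flooded for `↑S`;
* `IsFrontierSet.lowEdges_iff` — for a configuration `K ⊇ S`: the low edges of `K` are exactly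
  `S` iff every flooded-for-`S` face UNDER an `S`-edge is flooded for `K`;
* `determinedBy_frontierEvent`, `measurableSet_frontierEvent` — locality: the witnessing dual
  paths run inside `belowFaces`, and membership of a below pair in the cluster of `S` is decided
  by an open path to `S` through BELOW VERTICES (vertices off `S` all of whose faces are flooded:
  one flooded face around a vertex off `S` floods all of them, `mem_belowFaces_of_corner`), all of
  whose edges are below pairs (`edges_mem_belowPairs_of_walk`);
* `isAboveVertex_clusterConfig_iff`, `not_mem_belowPairs_of_isAboveVertex`,
  `not_mem_belowPairs_of_lt_apply_zero` — FRESHNESS: on `E_S` the above vertices of the cluster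
  configuration are the above vertices of `↑S`, and an edge at an above vertex of `↑S`, or at a
  vertex to the right of `R`, is not a below pair (this is how the open walk produced by
  `LowPath.exists_tipCatch` is read on fresh pairs only).

## References

* H. Kesten, *Scaling relations for 2D-percolation*, Comm. Math. Phys. 109 (1987), §2, Lemma 4
  [KestenScalingCMP1987].
* P. Nolin, *Near-critical percolation in two dimensions*, EJP 13 (2008), §4.4, Lemma 15 and its
  proof (arXiv 0711.4948: Lemma 14, p. 11) [Nolin2008].
* B. Bollobás, O. Riordan, *Percolation* (2006), Ch. 3, Lemma 1 and proof of Lemma 4 ("the event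
  `{LV(S) = P₁}` does not depend on the states of bonds of `S` to the right of `P₁`")
  [BollobasRiordan2006].
* H. Kesten, *Percolation theory for mathematicians* (1982), §2.2–2.3 [KestenPTM1982].

## Tree

`dualBelowR`, `IsAboveFace`, `IsLowEdge`, `LowPath`, `IsLowVertex`, `IsAboveVertex`,
`mem_dualBelowR_of_adj`, `mem_of_adj_dualBelowR`, `IsAboveFace.of_adj`,
`IsAboveVertex.isAboveFace_of_corner` (`ZdLowestFrontier.lean`); `belowEdges`, `squareEdges`,
`mem_dualConfig_iff_of_inter_eq` (`LowestCrossing.lean`); `cornerFaces`,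
`mem_sepEdge_of_cornerFaces` (`ZdFiveArmUniqueness.lean`); `edgeVerts` (`CrossingChains.lean`); `cornerFaces_of_mem_dualEdge`,
`exists_cornerWalk_mem_dualRectangle` (`ZdLowestFrontierFeet.lean`); `exists_prefix_exit`
(`FourArmGarbanTwoArms.lean`); `DeterminedBy` (`PercolationEvents.lean`).
-/

noncomputable section

open SimpleGraph Finset

namespace Literature.Probability.Percolation

open LatticeModels

variable {M N : ℕ} {ω ω' : BondConfig (Site 2)} {S : Finset (Sym2 (Site 2))}

/-! ### Monotonicity of the frontier notions in the configuration -/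

/-- **Opening edges shrinks the flooded region**: `dualBelowR` is antitone in the configuration.
[folklore] -/
theorem dualBelowR_anti (h : ω ⊆ ω') : dualBelowR M N ω' ⊆ dualBelowR M N ω := by
  intro f hf
  obtain ⟨hfR, b, hb, hconn⟩ := mem_dualBelowR_iff.1 hf
  obtain ⟨W, hWS, hWω⟩ :=
    exists_walk_of_mem_openConnIn (fun _ h => h.1 : dualConfig ω' ⊆ (zdGraph 2).edgeSet) hconn
  exact mem_dualBelowR_iff.2 ⟨hfR, b, hb, mem_openConnIn_of_walk W hWS fun e he =>
    dualConfig_antitone h (hWω e he)⟩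

/-- The off-below region grows with the configuration. [folklore] -/
theorem offBelow_mono (h : ω ⊆ ω') : offBelow M N ω ⊆ offBelow M N ω' :=
  fun _ hg => ⟨hg.1, fun hB => hg.2 (dualBelowR_anti h hB)⟩

/-- **Opening edges enlarges the region above**: `IsAboveFace` is monotone in the configuration.
[folklore] -/
theorem IsAboveFace.mono {f : Site 2} (hf : IsAboveFace M N ω f) (h : ω ⊆ ω') : IsAboveFace M N ω' f := by
  obtain ⟨t, ht, hconn⟩ := hf
  obtain ⟨W, hWS, hWω⟩ := exists_walk_of_mem_openConnIn (subset_refl _) hconn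
  exact ⟨t, ht, mem_openConnIn_of_walk W (fun z hz => offBelow_mono h (hWS z hz)) hWω⟩

/-- Every face on the way from the top face row to an above face is above. [folklore] -/
theorem IsAboveFace.exists_walk_isAboveFace {f : Site 2} (hf : IsAboveFace M N ω f) :
    ∃ t ∈ dualTopSide M N, ∃ q : (zdGraph 2).Walk t f, ∀ z ∈ q.support, IsAboveFace M N ω z := by
  classical
  obtain ⟨t, ht, q, hq⟩ := hf.exists_walk
  refine ⟨t, ht, q, fun z hz => ⟨t, ht, ?_⟩⟩
  exact mem_openConnIn_of_walk (q.takeUntil z hz) (fun w hw => hq w (q.support_takeUntil_subset_support hz hw))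
    fun e he => q.edges_subset_edgeSet (q.edges_takeUntil_subset_edges hz he)

/-! ### Lattice edges and their two faces -/

/-- A lattice edge is the separating edge of its two faces. [folklore] -/
theorem exists_adj_sepEdge_eq {e : Sym2 (Site 2)} (he : e ∈ (zdGraph 2).edgeSet) :
    ∃ g g' : Site 2, (zdGraph 2).Adj g g' ∧ sepEdge g g' = e := by
  have hde : dualEdge e ∈ (zdGraph 2).edgeSet := dualEdge_mem_edgeSet_holds he
  generalize hq : dualEdge e = q at hde
  induction q using Sym2.ind with
  | h g g' =>
    have hgg' : (zdGraph 2).Adj g g' := hde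
    exact ⟨g, g', hgg', dualEdge_injOn_holds (sepEdge_mem_edgeSet hgg') he (by rw [hq, dualEdge_sepEdge hgg'])⟩

/-- The lower face of the separating edge of `g`, `g'` is `g` — `sepEdge g g'` bounds the face `g`.
[folklore] -/
theorem sepEdge_mem_squareEdges {g g' : Site 2} (h : (zdGraph 2).Adj g g') : sepEdge g g' ∈ squareEdges g :=
  mem_squareEdges_of_mem_dualEdge (sepEdge_mem_edgeSet h) (by rw [dualEdge_sepEdge h]; exact Sym2.mem_mk_left _ _)

/-- `sepEdge g g'` bounds the face `g'` as well. [folklore] -/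
theorem sepEdge_mem_squareEdges' {g g' : Site 2} (h : (zdGraph 2).Adj g g') : sepEdge g g' ∈ squareEdges g' :=
  mem_squareEdges_of_mem_dualEdge (sepEdge_mem_edgeSet h) (by rw [dualEdge_sepEdge h]; exact Sym2.mem_mk_right _ _)

/-- One of the two faces of an edge of `R` lies in `R*` (`M ≥ 1`). [folklore] -/
theorem sepEdge_face_mem_dualRectangle (hM : 1 ≤ M) {g g' : Site 2} (h : (zdGraph 2).Adj g g')
    (hR : ∀ x ∈ sepEdge g g', x ∈ rectangle M N) : g ∈ dualRectangle M N ∨ g' ∈ dualRectangle M N := by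
  have hlo := mem_rectangle_iff.1 (hR _ (by rw [sepEdge]; exact Sym2.mem_mk_left _ _))
  have hhi := mem_rectangle_iff.1 (hR _ (by rw [sepEdge]; exact Sym2.mem_mk_right _ _))
  rw [mem_dualRectangle_iff, mem_dualRectangle_iff]
  rcases ZdDual.sep_cases h with ⟨h0, h1, hlo0, hlo1, hhi0, hhi1⟩ | ⟨h0, h1, hlo0, hlo1, hhi0, hhi1⟩ |
      ⟨h1, h0, hlo0, hlo1, hhi0, hhi1⟩ | ⟨h1, h0, hlo0, hlo1, hhi0, hhi1⟩ <;> omega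

/-! ### The objects: below faces, below pairs, the cluster of `S`, frontier sets, the event -/

/-- **The faces below `S`**: the faces of `R* = [0,M-1] × [-1,N]` flooded from the bottom face
row by dual paths of `R*` not crossing `S` — the region below the lowest crossing computed for the
configuration `↑S` whose only open edges are those of `S`. [folklore] -/
def belowFaces (M N : ℕ) (S : Finset (Sym2 (Site 2))) : Finset (Site 2) :=
  dualBelowR M N (↑S : BondConfig (Site 2))

/-- **The below pairs of `S`**: the lattice edges bounding a face below `S` (these include the
edges of `S` when `S` is a frontier set). The event `frontierEvent M N S` reads only these pairs.
[cite: BollobasRiordan2006, Ch. 3, proof of Lemma 4] -/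
def belowPairs (M N : ℕ) (S : Finset (Sym2 (Site 2))) : Finset (Sym2 (Site 2)) :=
  belowEdges (belowFaces M N S)

/-- **The cluster configuration of `S` in `(R, ω)`**: the open lattice edges of `ω` inside `R`
joined inside `R` to a vertex of `S` by an `ω`-open lattice walk (for `S ⊆ ω` an open path: the
edges of the open cluster of `S` in the rectangle). [folklore] -/
def clusterConfig (M N : ℕ) (ω : BondConfig (Site 2)) (S : Finset (Sym2 (Site 2))) : BondConfig (Site 2) :=
  {e | e ∈ ω ∧ e ∈ (zdGraph 2).edgeSet ∧ (∀ x ∈ e, x ∈ rectangle M N) ∧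
    ∃ x ∈ e, ∃ y ∈ edgeVerts ↑S, ∃ W : (zdGraph 2).Walk y x,
      (∀ z ∈ W.support, z ∈ rectangle M N) ∧ ∀ e' ∈ W.edges, e' ∈ ω}

/-- **A frontier set**: a finite set `S` of pairs which is exactly the set of low edges of the
configuration `↑S`, and for which no top face is flooded (i.e. `↑S` has a left–right crossing);
by `LowPath.isFrontierSet_edges` these are exactly the edge sets of lowest crossings. [folklore] -/
def IsFrontierSet (M N : ℕ) (S : Finset (Sym2 (Site 2))) : Prop :=
  (∀ e, IsLowEdge M N (↑S : BondConfig (Site 2)) e ↔ e ∈ S) ∧ ∀ t ∈ dualTopSide M N, t ∉ belowFaces M N S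

/-- **The event "the frontier of the cluster of `S` is `S`"**: `S` is open and the low edges of
the cluster configuration of `S` are exactly the edges of `S` (Nolin's `E_u`, one crossing cluster
at a time). [cite: Nolin2008, §4.4, proof of Lemma 15 (arXiv 0711.4948: Lemma 14, p. 11), the events E_u] -/
def frontierEvent (M N : ℕ) (S : Finset (Sym2 (Site 2))) : Set (BondConfig (Site 2)) :=
  {ω | (↑S : Set (Sym2 (Site 2))) ⊆ ω ∧ ∀ e, IsLowEdge M N (clusterConfig M N ω S) e ↔ e ∈ S}

/-! ### Basic API -/

/-- Membership in `edgeVerts ↑S` for a finite set of pairs `S`. [folklore] -/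
theorem mem_edgeVerts_coe_iff {x : Site 2} : x ∈ edgeVerts (↑S : Set (Sym2 (Site 2))) ↔ ∃ s ∈ S, x ∈ s := Iff.rfl

/-- Membership in `belowPairs`: the pair bounds a face below `S`. [folklore] -/
theorem mem_belowPairs_iff {e : Sym2 (Site 2)} :
    e ∈ belowPairs M N S ↔ ∃ g ∈ belowFaces M N S, e ∈ squareEdges g := by
  simp [belowPairs, belowEdges]

/-- The faces below `S` lie in `R*`. [folklore] -/
theorem belowFaces_subset : belowFaces M N S ⊆ dualRectangle M N := dualBelowR_subset

/-- Membership in the cluster configuration, unfolded. [folklore] -/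
theorem mem_clusterConfig_iff {e : Sym2 (Site 2)} :
    e ∈ clusterConfig M N ω S ↔ e ∈ ω ∧ e ∈ (zdGraph 2).edgeSet ∧ (∀ x ∈ e, x ∈ rectangle M N) ∧
      ∃ x ∈ e, ∃ y ∈ edgeVerts ↑S, ∃ W : (zdGraph 2).Walk y x,
        (∀ z ∈ W.support, z ∈ rectangle M N) ∧ ∀ e' ∈ W.edges, e' ∈ ω := Iff.rfl

/-- The cluster configuration is a sub-configuration. [folklore] -/
theorem clusterConfig_subset : clusterConfig M N ω S ⊆ ω := fun _ h => h.1

/-- The cluster configuration is a lattice configuration. [folklore] -/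
theorem clusterConfig_subset_edgeSet : clusterConfig M N ω S ⊆ (zdGraph 2).edgeSet := fun _ h => h.2.1

/-- The edges of the cluster configuration lie in `R`. [folklore] -/
theorem mem_rectangle_of_mem_clusterConfig {e : Sym2 (Site 2)} (he : e ∈ clusterConfig M N ω S) :
    ∀ x ∈ e, x ∈ rectangle M N := he.2.2.1

/-- `S` (open, inside `R`, lattice) lies in its own cluster configuration. [folklore] -/
theorem subset_clusterConfig (hSE : ∀ e ∈ S, e ∈ (zdGraph 2).edgeSet ∧ ∀ x ∈ e, x ∈ rectangle M N)
    (hSω : (↑S : Set (Sym2 (Site 2))) ⊆ ω) : (↑S : Set (Sym2 (Site 2))) ⊆ clusterConfig M N ω S := by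
  intro e he
  have he' : e ∈ S := Finset.mem_coe.1 he
  obtain ⟨hE, hR⟩ := hSE e he'
  induction e using Sym2.ind with
  | h x y =>
    exact ⟨hSω he, hE, hR, x, Sym2.mem_mk_left _ _, x, ⟨_, he', Sym2.mem_mk_left _ _⟩, Walk.nil,
      fun z hz => by rw [Walk.support_nil, List.mem_singleton] at hz; rw [hz]; exact hR x (Sym2.mem_mk_left _ _),
      fun e' he' => by simp at he'⟩

/-- The frontier event, unfolded. [folklore] -/
theorem mem_frontierEvent_iff : ω ∈ frontierEvent M N S ↔
    (↑S : Set (Sym2 (Site 2))) ⊆ ω ∧ ∀ e, IsLowEdge M N (clusterConfig M N ω S) e ↔ e ∈ S := Iff.rfl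

namespace IsFrontierSet

/-- A frontier set consists of lattice edges. [folklore] -/
theorem subset_edgeSet (hS : IsFrontierSet M N S) : (↑S : Set (Sym2 (Site 2))) ⊆ (zdGraph 2).edgeSet :=
  fun e he => ((hS.1 e).2 (Finset.mem_coe.1 he)).mem_edgeSet

/-- The edges of a frontier set lie in `R`. [folklore] -/
theorem mem_rectangle (hS : IsFrontierSet M N S) {e : Sym2 (Site 2)} (he : e ∈ S) :
    ∀ x ∈ e, x ∈ rectangle M N :=
  ((hS.1 e).2 he).mem_rectangle hS.2

/-- A frontier set lies in its cluster configuration as soon as it is open. [folklore] -/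
theorem subset_clusterConfig (hS : IsFrontierSet M N S) (hSω : (↑S : Set (Sym2 (Site 2))) ⊆ ω) :
    (↑S : Set (Sym2 (Site 2))) ⊆ clusterConfig M N ω S :=
  Percolation.subset_clusterConfig (fun _ he => ⟨hS.subset_edgeSet (Finset.mem_coe.2 he), hS.mem_rectangle he⟩) hSω

/-- The edges of a frontier set are below pairs (each bounds its face below). [folklore] -/
theorem subset_belowPairs (hS : IsFrontierSet M N S) : S ⊆ belowPairs M N S := by
  intro e he
  obtain ⟨g, f, hgf, hg, -, rfl⟩ := (hS.1 e).2 he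
  exact mem_belowPairs_iff.2 ⟨g, hg, sepEdge_mem_squareEdges hgf⟩

end IsFrontierSet

/-- Membership in `belowFaces`, unfolded. [folklore] -/
theorem mem_belowFaces_iff {g : Site 2} : g ∈ belowFaces M N S ↔ g ∈ dualBelowR M N (↑S : BondConfig (Site 2)) :=
  Iff.rfl

/-- Separating edges of adjacent faces, one of them below, are below pairs. [folklore] -/
theorem sepEdge_mem_belowPairs {g f : Site 2} (h : (zdGraph 2).Adj g f) (hg : g ∈ belowFaces M N S) :
    sepEdge g f ∈ belowPairs M N S :=
  mem_belowPairs_iff.2 ⟨g, hg, sepEdge_mem_squareEdges h⟩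

/-! ### A left–right crossing keeps the top face row dry -/

/-- **An open left–right crossing of `R` blocks the flood**: if `ω` has an `ω`-open lattice walk
inside `R` from the left side to the right side, no top face of `R*` is flooded (a flooding dual
path would cross the walk at a closed edge, `exists_dart_sepEdge_mem_edges`). [cite: KestenPTM1982, §2.2 (paths crossing a rectangle must intersect)] -/
theorem not_mem_dualBelowR_of_lrWalk {a b : Site 2} (π : (zdGraph 2).Walk a b) (ha : a 0 = 0) (hb : b 0 = M)
    (hπR : ∀ z ∈ π.support, z ∈ rectangle M N) (hπω : ∀ e ∈ π.edges, e ∈ ω) :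
    ∀ t ∈ dualTopSide M N, t ∉ dualBelowR M N ω := by
  intro t ht htB
  obtain ⟨-, s, hs, hconn⟩ := mem_dualBelowR_iff.1 htB
  obtain ⟨Q, hQS, hQe⟩ :=
    exists_walk_of_mem_openConnIn (fun _ h => h.1 : dualConfig ω ⊆ (zdGraph 2).edgeSet) hconn
  have ht1 : t 1 = N := (Finset.mem_filter.1 ht).2
  have hs1 : s 1 = -1 := (Finset.mem_filter.1 hs).2
  obtain ⟨d, hd, hde⟩ := exists_dart_sepEdge_mem_edges (M := M) (N := N) π Q.reverse
    (fun z hz => by have := mem_rectangle_iff.1 (hπR z hz); omega)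
    (fun z hz => by
      rw [Walk.support_reverse, List.mem_reverse] at hz
      have := mem_dualRectangle_iff.1 (Finset.mem_coe.1 (hQS z hz)); omega) ha hb ht1 hs1
  have hopen : s(d.fst, d.snd) ∈ dualConfig ω := by
    refine hQe _ ?_
    have : s(d.fst, d.snd) ∈ Q.reverse.edges := by rw [Walk.edges]; exact List.mem_map.2 ⟨d, hd, rfl⟩
    rwa [Walk.edges_reverse, List.mem_reverse] at this
  exact ZdDual.sepEdge_not_mem_of_mem_dualConfig d.adj hopen (hπω _ hde)

/-! ### The lowest crossing of any configuration is a frontier set (no Jordan curve theorem) -/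

namespace LowPath

variable (Λ : LowPath M N ω)

/-- The edge set of the lowest crossing, as a finite set of pairs. [folklore] -/
def edgeFinset : Finset (Sym2 (Site 2)) := Λ.path.edges.toFinset

/-- Membership in `edgeFinset`. [folklore] -/
theorem mem_edgeFinset_iff {e : Sym2 (Site 2)} : e ∈ Λ.edgeFinset ↔ e ∈ Λ.path.edges := List.mem_toFinset

/-- The edges of the lowest crossing are open. [folklore] -/
theorem coe_edgeFinset_subset (hω : ω ⊆ (zdGraph 2).edgeSet) : (↑Λ.edgeFinset : Set (Sym2 (Site 2))) ⊆ ω :=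
  fun _ he => Λ.mem_of_mem_edges hω (Λ.mem_edgeFinset_iff.1 (Finset.mem_coe.1 he))

/-- The edges of the lowest crossing are lattice edges. [folklore] -/
theorem coe_edgeFinset_subset_edgeSet : (↑Λ.edgeFinset : Set (Sym2 (Site 2))) ⊆ (zdGraph 2).edgeSet :=
  fun _ he => Λ.path.edges_subset_edgeSet (Λ.mem_edgeFinset_iff.1 (Finset.mem_coe.1 he))

/-- The lowest crossing has an edge (`M ≥ 1`). [folklore] -/
theorem edgeFinset_nonempty (hM : 1 ≤ M) : Λ.edgeFinset.Nonempty := by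
  have hnil : ¬ Λ.path.Nil := by
    intro h
    have h1 := Λ.left
    have h2 := Λ.right
    rw [h.eq] at h1
    omega
  obtain ⟨e, he, -⟩ := (Walk.mem_support_iff_exists_mem_edges_of_not_nil hnil).1 Λ.path.start_mem_support
  exact ⟨e, Λ.mem_edgeFinset_iff.2 he⟩

/-- The faces flooded for `ω` are flooded for the lowest crossing alone. [folklore] -/
theorem dualBelowR_subset_belowFaces (hω : ω ⊆ (zdGraph 2).edgeSet) :
    dualBelowR M N ω ⊆ belowFaces M N Λ.edgeFinset :=
  dualBelowR_anti (Λ.coe_edgeFinset_subset hω)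

/-- **An above face is not flooded for the lowest crossing alone.**  A flooding dual path of `R*`
from the bottom face row to an above face `f`, crossing no edge of `Λ`, read backwards from `f`,
leaves the above faces of `ω` at a first step `q → q'`; `q'` is flooded for `ω` (then the edge
between them is a low edge, i.e. an edge of `Λ` — excluded) or off the flooded region (then it
is above, by `IsAboveFace.of_adj` — excluded). No planar separation theorem is needed. [folklore] -/
theorem not_mem_belowFaces_of_isAboveFace {f : Site 2} (hf : IsAboveFace M N ω f) :
    f ∉ belowFaces M N Λ.edgeFinset := by
  intro hfB
  obtain ⟨-, b₀, hb₀, hconn⟩ := mem_dualBelowR_iff.1 hfB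
  obtain ⟨δ, hδS, hδe⟩ := exists_walk_of_mem_openConnIn
    (fun _ h => h.1 : dualConfig (↑Λ.edgeFinset : BondConfig (Site 2)) ⊆ (zdGraph 2).edgeSet) hconn
  have hb₀A : ¬ IsAboveFace M N ω b₀ := fun h =>
    h.not_mem_dualBelowR (mem_dualBelowR_of_mem_dualBottomSide hb₀)
  obtain ⟨q, q', δ₁, hqq', hq', hA, -, -, hlast⟩ :=
    exists_prefix_exit (A := {z | IsAboveFace M N ω z}) δ.reverse hf hb₀A
  have hq : IsAboveFace M N ω q := hA q δ₁.end_mem_support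
  rw [Walk.edges_reverse, List.mem_reverse] at hlast
  have hq'R : q' ∈ dualRectangle M N := Finset.mem_coe.1 (hδS q' (δ.snd_mem_support_of_mem_edges hlast))
  have hopen : s(q, q') ∈ dualConfig (↑Λ.edgeFinset : BondConfig (Site 2)) := hδe _ hlast
  have hnot : sepEdge q q' ∉ (↑Λ.edgeFinset : Set (Sym2 (Site 2))) :=
    ZdDual.sepEdge_not_mem_of_mem_dualConfig hqq' hopen
  by_cases hq'B : q' ∈ dualBelowR M N ω
  · have hle : IsLowEdge M N ω (sepEdge q' q) := ⟨q', q, hqq'.symm, hq'B, hq, rfl⟩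
    refine hnot ?_
    rw [sepEdge_comm]
    exact Finset.mem_coe.2 (Λ.mem_edgeFinset_iff.2 ((Λ.mem_edges_iff _).2 hle))
  · exact hq' (hq.of_adj hqq' hq'R hq'B)

/-- An above face of `ω` is an above face of the lowest crossing alone. [folklore] -/
theorem isAboveFace_coe_of_isAboveFace {f : Site 2} (hf : IsAboveFace M N ω f) :
    IsAboveFace M N (↑Λ.edgeFinset : BondConfig (Site 2)) f := by
  obtain ⟨t, ht, q, hq⟩ := hf.exists_walk_isAboveFace
  exact ⟨t, ht, mem_openConnIn_of_walk q
    (fun z hz => ⟨(hq z hz).mem_dualRectangle, Λ.not_mem_belowFaces_of_isAboveFace (hq z hz)⟩)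
    fun e he => q.edges_subset_edgeSet he⟩

/-- **The edge set of the lowest crossing of a lattice configuration is a frontier set.** [folklore] -/
theorem isFrontierSet_edgeFinset (hω : ω ⊆ (zdGraph 2).edgeSet) (hT : ∀ t ∈ dualTopSide M N, t ∉ dualBelowR M N ω) :
    IsFrontierSet M N Λ.edgeFinset := by
  refine ⟨fun e => ⟨?_, fun he => ?_⟩, fun t ht htB => ?_⟩
  · rintro ⟨g, f, hgf, hg, hf, rfl⟩
    exact Finset.mem_coe.1 (mem_of_adj_dualBelowR Λ.coe_edgeFinset_subset_edgeSet hg hf.mem_dualRectangle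
      hf.not_mem_dualBelowR hgf)
  · obtain ⟨g, f, hgf, hg, hf, rfl⟩ := (Λ.mem_edges_iff _).1 (Λ.mem_edgeFinset_iff.1 he)
    exact ⟨g, f, hgf, Λ.dualBelowR_subset_belowFaces hω hg, Λ.isAboveFace_coe_of_isAboveFace hf, rfl⟩
  · exact Λ.not_mem_belowFaces_of_isAboveFace (isAboveFace_of_mem_dualTopSide ht (hT t ht)) htB

end LowPath

/-! ### Low edges of a configuration containing a frontier set -/

namespace IsFrontierSet

variable {K : BondConfig (Site 2)}

/-- For a configuration `K` such that every face below `S` under an `S`-edge is flooded for `K`: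
an above face of `K` is not below `S` (the first entrance of its above path into the faces below
`S` would cross an `S`-edge from its above face to its below face, which is flooded for `K`, not
above). [folklore] -/
theorem not_mem_belowFaces_of_isAboveFace (hS : IsFrontierSet M N S)
    (hR : ∀ ⦃g f : Site 2⦄, (zdGraph 2).Adj g f → g ∈ belowFaces M N S →
      IsAboveFace M N (↑S : BondConfig (Site 2)) f → g ∈ dualBelowR M N K)
    {f : Site 2} (hf : IsAboveFace M N K f) : f ∉ belowFaces M N S := by
  intro hfB
  obtain ⟨t, ht, q, hq⟩ := hf.exists_walk_isAboveFace
  have htB : t ∉ belowFaces M N S := hS.2 t ht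
  obtain ⟨p, p', q₁, hpp', hp', hA, hSup, -, hlast⟩ :=
    exists_prefix_exit (A := {z | z ∉ belowFaces M N S}) q htB (fun h => h hfB)
  have hp'B : p' ∈ belowFaces M N S := not_not.1 hp'
  have hpA : IsAboveFace M N (↑S : BondConfig (Site 2)) p :=
    ⟨t, ht, mem_openConnIn_of_walk q₁ (fun z hz => ⟨(hq z (hSup z hz)).mem_dualRectangle, hA z hz⟩)
      fun e he => q₁.edges_subset_edgeSet he⟩
  have hp'K : p' ∈ dualBelowR M N K := hR hpp'.symm hp'B hpA
  exact (hq p' (q.snd_mem_support_of_mem_edges hlast)).not_mem_dualBelowR hp'K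

/-- Under the same hypothesis, above faces of `K` are above faces of `↑S`. [folklore] -/
theorem isAboveFace_coe_of_isAboveFace (hS : IsFrontierSet M N S)
    (hR : ∀ ⦃g f : Site 2⦄, (zdGraph 2).Adj g f → g ∈ belowFaces M N S →
      IsAboveFace M N (↑S : BondConfig (Site 2)) f → g ∈ dualBelowR M N K)
    {f : Site 2} (hf : IsAboveFace M N K f) : IsAboveFace M N (↑S : BondConfig (Site 2)) f := by
  obtain ⟨t, ht, q, hq⟩ := hf.exists_walk_isAboveFace
  exact ⟨t, ht, mem_openConnIn_of_walk q
    (fun z hz => ⟨(hq z hz).mem_dualRectangle, hS.not_mem_belowFaces_of_isAboveFace hR (hq z hz)⟩)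
    fun e he => q.edges_subset_edgeSet he⟩

/-- **The low edges of `K ⊇ S` are exactly `S` iff every face below `S` under an `S`-edge is
flooded for `K`** (`S` a frontier set).  "If": the `S`-edges are then low for `K` (their above
faces are above for `K` by monotonicity), and a low edge of `K` separates a face flooded for `K`
(hence below `S`) from an above face of `K` (hence not below `S`), so it is an `S`-edge (the
flood boundary of `↑S` is `S`). [folklore] -/
theorem lowEdges_iff (hS : IsFrontierSet M N S) (hK : (↑S : Set (Sym2 (Site 2))) ⊆ K) :
    (∀ e, IsLowEdge M N K e ↔ e ∈ S) ↔
      ∀ ⦃g f : Site 2⦄, (zdGraph 2).Adj g f → g ∈ belowFaces M N S →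
        IsAboveFace M N (↑S : BondConfig (Site 2)) f → g ∈ dualBelowR M N K := by
  constructor
  · intro hE g f hgf hg hf
    have hle : IsLowEdge M N (↑S : BondConfig (Site 2)) (sepEdge g f) := ⟨g, f, hgf, hg, hf, rfl⟩
    obtain ⟨g', f', hgf', hg', hf', heq⟩ := (hE _).2 ((hS.1 _).1 hle)
    rcases Sym2.eq_iff.1 (sepEdge_injective hgf hgf' heq) with ⟨h1, -⟩ | ⟨-, h2⟩
    · rw [h1]; exact hg'
    · have hfK : f ∈ dualBelowR M N K := by rw [h2]; exact hg'
      exact absurd (dualBelowR_anti hK hfK) hf.not_mem_dualBelowR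
  · intro hR e
    constructor
    · rintro ⟨g, f, hgf, hg, hf, rfl⟩
      have hfB : f ∉ belowFaces M N S := hS.not_mem_belowFaces_of_isAboveFace hR hf
      have hgB : g ∈ belowFaces M N S := dualBelowR_anti hK hg
      exact Finset.mem_coe.1 (mem_of_adj_dualBelowR hS.subset_edgeSet hgB hf.mem_dualRectangle hfB hgf)
    · intro he
      obtain ⟨g, f, hgf, hg, hf, rfl⟩ := (hS.1 e).2 he
      exact ⟨g, f, hgf, hR hgf hg hf, hf.mono hK, rfl⟩

end IsFrontierSet

/-! ### Below vertices: locality of the cluster of `S` on the below pairs -/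

/-- **One flooded face around a vertex off `S` floods every face of `R*` around it** (the steps
around the vertex cross edges at the vertex, none of which is in `S`). [folklore] -/
theorem mem_belowFaces_of_corner (hSE : (↑S : Set (Sym2 (Site 2))) ⊆ (zdGraph 2).edgeSet) {v : Site 2}
    (hv : v ∈ rectangle M N) (hvS : v ∉ edgeVerts ↑S) {z z' : Site 2} (hz : z ∈ cornerFaces v)
    (hzB : z ∈ belowFaces M N S) (hz' : z' ∈ cornerFaces v) (hz'R : z' ∈ dualRectangle M N) :
    z' ∈ belowFaces M N S := by
  obtain ⟨J, hJ⟩ := exists_cornerWalk_mem_dualRectangle hv hz (belowFaces_subset hzB) hz' hz'R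
  have hJω : ∀ e ∈ J.edges, e ∈ dualConfig (↑S : BondConfig (Site 2)) := by
    intro e he
    rw [Walk.edges, List.mem_map] at he
    obtain ⟨d, hd, rfl⟩ := he
    have h1 := hJ _ (J.dart_fst_mem_support_of_mem_darts hd)
    have h2 := hJ _ (J.dart_snd_mem_support_of_mem_darts hd)
    exact (mem_dualConfig_mk_iff hSE d.adj).2 fun hmem =>
      hvS ⟨_, Finset.mem_coe.1 hmem, mem_sepEdge_of_cornerFaces h1.1 h2.1 d.adj⟩
  obtain ⟨-, b, hb, hconn⟩ := mem_dualBelowR_iff.1 hzB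
  exact mem_dualBelowR_iff.2 ⟨hz'R, b, hb, PlanarDuality.openConnIn_trans hconn
    (mem_openConnIn_of_walk J (fun w hw => Finset.mem_coe.2 (hJ w hw).2) hJω)⟩

/-- **A walk of `R` through vertices off `S`, starting at a vertex with a flooded face around
it, uses only below pairs** (and every vertex of it has a flooded face around it). [folklore] -/
theorem edges_mem_belowPairs_of_walk (hM : 1 ≤ M) (hSE : (↑S : Set (Sym2 (Site 2))) ⊆ (zdGraph 2).edgeSet)
    {a b : Site 2} (Q : (zdGraph 2).Walk a b) (hQR : ∀ z ∈ Q.support, z ∈ rectangle M N)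
    (hQS : ∀ d ∈ Q.darts, d.fst ∉ edgeVerts ↑S) (ha : ∃ z ∈ cornerFaces a, z ∈ belowFaces M N S) :
    ∀ e ∈ Q.edges, e ∈ belowPairs M N S := by
  induction Q with
  | nil => simp
  | cons h Q' ih =>
    rename_i u v w
    obtain ⟨z, hz, hzB⟩ := ha
    have huS : u ∉ edgeVerts ↑S := hQS ⟨(u, v), h⟩ (by rw [Walk.darts_cons]; exact List.mem_cons_self)
    have huR : u ∈ rectangle M N := hQR u (Walk.start_mem_support _)
    have hvR : v ∈ rectangle M N :=
      hQR v (by rw [Walk.support_cons]; exact List.mem_cons_of_mem _ Q'.start_mem_support)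
    have hE : s(u, v) ∈ (zdGraph 2).edgeSet := (SimpleGraph.mem_edgeSet _).2 h
    obtain ⟨g, g', hgg', hge⟩ := exists_adj_sepEdge_eq hE
    have hR2 : ∀ x ∈ sepEdge g g', x ∈ rectangle M N := by
      rw [hge]; intro x hx
      rcases Sym2.mem_iff.1 hx with rfl | rfl
      · exact huR
      · exact hvR
    have key : ∀ g₀, g₀ ∈ dualEdge s(u, v) → g₀ ∈ dualRectangle M N →
        s(u, v) ∈ belowPairs M N S ∧ ∃ z ∈ cornerFaces v, z ∈ belowFaces M N S := by
      intro g₀ hg₀ hg₀R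
      have hgu : g₀ ∈ cornerFaces u := cornerFaces_of_mem_dualEdge hE (Sym2.mem_mk_left _ _) hg₀
      have hgv : g₀ ∈ cornerFaces v := cornerFaces_of_mem_dualEdge hE (Sym2.mem_mk_right _ _) hg₀
      have hg₀B : g₀ ∈ belowFaces M N S := mem_belowFaces_of_corner hSE huR huS hz hzB hgu hg₀R
      exact ⟨mem_belowPairs_iff.2 ⟨g₀, hg₀B, mem_squareEdges_of_mem_dualEdge hE hg₀⟩, g₀, hgv, hg₀B⟩
    have hde : dualEdge s(u, v) = s(g, g') := by rw [← hge, dualEdge_sepEdge hgg']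
    obtain ⟨he, hv'⟩ : s(u, v) ∈ belowPairs M N S ∧ ∃ z ∈ cornerFaces v, z ∈ belowFaces M N S := by
      rcases sepEdge_face_mem_dualRectangle hM hgg' hR2 with hgR | hg'R
      · exact key g (by rw [hde]; exact Sym2.mem_mk_left _ _) hgR
      · exact key g' (by rw [hde]; exact Sym2.mem_mk_right _ _) hg'R
    intro e he'
    rw [Walk.edges_cons, List.mem_cons] at he'
    rcases he' with rfl | he'
    · exact he
    · exact ih (fun z hz => hQR z (by rw [Walk.support_cons]; exact List.mem_cons_of_mem _ hz))
        (fun d hd => hQS d (by rw [Walk.darts_cons]; exact List.mem_cons_of_mem _ hd)) hv' e he'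

/-- **Locality of the cluster on the below pairs**: if `ω` and `ω'` agree on the below pairs of
`S`, a below pair in the cluster configuration of `S` for `ω'` is in it for `ω` (follow the
`ω'`-open walk to `S` up to its first vertex of `S`: its vertices are below vertices, its edges
below pairs, hence `ω`-open). [cite: BollobasRiordan2006, Ch. 3, proof of Lemma 4] -/
theorem mem_clusterConfig_of_inter_eq (hM : 1 ≤ M) (hSE : (↑S : Set (Sym2 (Site 2))) ⊆ (zdGraph 2).edgeSet)
    (h : ω ∩ ↑(belowPairs M N S) = ω' ∩ ↑(belowPairs M N S)) {e : Sym2 (Site 2)}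
    (heB : e ∈ belowPairs M N S) (he : e ∈ clusterConfig M N ω' S) : e ∈ clusterConfig M N ω S := by
  classical
  have agree : ∀ e' ∈ belowPairs M N S, e' ∈ ω' → e' ∈ ω := fun e' he' hω' =>
    ((Set.ext_iff.1 h e').2 ⟨hω', Finset.mem_coe.2 he'⟩).1
  obtain ⟨heω', heE, heR, x, hxe, y, hy, W, hWR, hWω'⟩ := he
  refine ⟨agree e heB heω', heE, heR, ?_⟩
  by_cases hxS : x ∈ edgeVerts ↑S
  · refine ⟨x, hxe, x, hxS, Walk.nil, fun z hz => ?_, fun e' he' => by simp at he'⟩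
    rw [Walk.support_nil, List.mem_singleton] at hz
    rw [hz]; exact heR x hxe
  obtain ⟨p, y₁, Q, hpy₁, hy₁, hA, hSup, hEdg, hlast⟩ :=
    exists_prefix_exit (A := {v | v ∉ edgeVerts ↑S}) W.reverse hxS (fun h' => h' hy)
  have hy₁S : y₁ ∈ edgeVerts ↑S := not_not.1 hy₁
  -- the walk `x → p → y₁` and its properties
  have hQ'R : ∀ z ∈ (Q.concat hpy₁).support, z ∈ rectangle M N := by
    intro z hz
    rw [Walk.support_concat, List.mem_append, List.mem_singleton] at hz
    rcases hz with hz | rfl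
    · exact hWR z (by have := hSup z hz; rwa [Walk.support_reverse, List.mem_reverse] at this)
    · exact hWR _ (by
        have := W.reverse.snd_mem_support_of_mem_edges hlast
        rwa [Walk.support_reverse, List.mem_reverse] at this)
  have hQ'S : ∀ d ∈ (Q.concat hpy₁).darts, d.fst ∉ edgeVerts ↑S := by
    intro d hd
    rw [Walk.darts_concat, List.concat_eq_append, List.mem_append, List.mem_singleton] at hd
    rcases hd with hd | rfl
    · exact hA _ (Q.dart_fst_mem_support_of_mem_darts hd)
    · exact hA p Q.end_mem_support
  have hQ'ω' : ∀ e' ∈ (Q.concat hpy₁).edges, e' ∈ ω' := by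
    intro e' he'
    rw [Walk.edges_concat, List.concat_eq_append, List.mem_append, List.mem_singleton] at he'
    rcases he' with he' | rfl
    · exact hWω' e' (by have := hEdg e' he'; rwa [Walk.edges_reverse, List.mem_reverse] at this)
    · exact hWω' _ (by rwa [Walk.edges_reverse, List.mem_reverse] at hlast)
  have hxB : ∃ z ∈ cornerFaces x, z ∈ belowFaces M N S := by
    obtain ⟨g, hg, hge⟩ := mem_belowPairs_iff.1 heB
    exact ⟨g, cornerFaces_of_mem_dualEdge heE hxe (mem_dualEdge_of_mem_squareEdges hge), hg⟩
  have hQ'B := edges_mem_belowPairs_of_walk hM hSE (Q.concat hpy₁) hQ'R hQ'S hxB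
  refine ⟨x, hxe, y₁, hy₁S, (Q.concat hpy₁).reverse, fun z hz => hQ'R z ?_, fun e' he' => ?_⟩
  · rwa [Walk.support_reverse, List.mem_reverse] at hz
  · rw [Walk.edges_reverse, List.mem_reverse] at he'
    exact agree e' (hQ'B e' he') (hQ'ω' e' he')

/-- **Locality of the flooded region of the cluster**: if `ω ⊇ S` and `ω'` agree on the below
pairs of the frontier set `S`, a face flooded for the cluster configuration of `S` in `ω` is
flooded for that in `ω'` (the flooding dual path runs through faces below `S` and crosses only
below pairs, whose membership in the cluster is local). [cite: BollobasRiordan2006, Ch. 3, proof of Lemma 4] -/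
theorem mem_dualBelowR_clusterConfig_of_inter_eq (hS : IsFrontierSet M N S) (hM : 1 ≤ M)
    (hSω : (↑S : Set (Sym2 (Site 2))) ⊆ ω) (h : ω ∩ ↑(belowPairs M N S) = ω' ∩ ↑(belowPairs M N S))
    {g : Site 2} (hg : g ∈ dualBelowR M N (clusterConfig M N ω S)) :
    g ∈ dualBelowR M N (clusterConfig M N ω' S) := by
  have hKS : dualBelowR M N (clusterConfig M N ω S) ⊆ belowFaces M N S :=
    dualBelowR_anti (hS.subset_clusterConfig hSω)
  obtain ⟨b, hb, hconn⟩ := exists_openConnIn_dualBelowR hg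
  obtain ⟨δ, hδS, hδe⟩ := exists_walk_of_mem_openConnIn
    (fun _ h => h.1 : dualConfig (clusterConfig M N ω S) ⊆ (zdGraph 2).edgeSet) hconn
  refine mem_dualBelowR_iff.2 ⟨dualBelowR_subset hg, b, hb, mem_openConnIn_of_walk δ
    (fun z hz => Finset.mem_coe.2 (dualBelowR_subset (Finset.mem_coe.1 (hδS z hz)))) fun e he => ?_⟩
  rw [Walk.edges, List.mem_map] at he
  obtain ⟨d, hd, rfl⟩ := he
  have hp : d.fst ∈ dualBelowR M N (clusterConfig M N ω S) :=
    Finset.mem_coe.1 (hδS _ (δ.dart_fst_mem_support_of_mem_darts hd))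
  have hopen : s(d.fst, d.snd) ∈ dualConfig (clusterConfig M N ω S) :=
    hδe _ (by rw [Walk.edges]; exact List.mem_map.2 ⟨d, hd, rfl⟩)
  have hnot : sepEdge d.fst d.snd ∉ clusterConfig M N ω S :=
    (mem_dualConfig_mk_iff clusterConfig_subset_edgeSet d.adj).1 hopen
  exact (mem_dualConfig_mk_iff clusterConfig_subset_edgeSet d.adj).2 fun hmem =>
    hnot (mem_clusterConfig_of_inter_eq hM hS.subset_edgeSet h (sepEdge_mem_belowPairs d.adj (hKS hp)) hmem)

/-! ### Locality of the frontier event -/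

/-- One direction of the locality of `frontierEvent`. [folklore] -/
theorem frontierEvent_of_inter_eq (hS : IsFrontierSet M N S) (hM : 1 ≤ M)
    (h : ω ∩ ↑(belowPairs M N S) = ω' ∩ ↑(belowPairs M N S)) (hω : ω ∈ frontierEvent M N S) :
    ω' ∈ frontierEvent M N S := by
  obtain ⟨hSω, hE⟩ := hω
  have hSω' : (↑S : Set (Sym2 (Site 2))) ⊆ ω' := fun e he =>
    ((Set.ext_iff.1 h e).1 ⟨hSω he, Finset.mem_coe.2 (hS.subset_belowPairs (Finset.mem_coe.1 he))⟩).1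
  have hR := (hS.lowEdges_iff (hS.subset_clusterConfig hSω)).1 hE
  exact ⟨hSω', (hS.lowEdges_iff (hS.subset_clusterConfig hSω')).2 fun g f hgf hg hf =>
    mem_dualBelowR_clusterConfig_of_inter_eq hS hM hSω h (hR hgf hg hf)⟩

/-- **Locality of the frontier event** ("`E_u` is independent from the status of the sites above
`c̃_u`"): for a frontier set `S`, `frontierEvent M N S` is determined by the below pairs of `S`.
[cite: Nolin2008, §4.4, proof of Lemma 15 (arXiv 0711.4948: Lemma 14, p. 11)] -/
theorem determinedBy_frontierEvent (hS : IsFrontierSet M N S) (hM : 1 ≤ M) :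
    DeterminedBy (frontierEvent M N S) ↑(belowPairs M N S) := by
  rw [determinedBy_iff]
  intro ω ω' h
  exact ⟨frontierEvent_of_inter_eq hS hM h, frontierEvent_of_inter_eq hS hM h.symm⟩

/-- The frontier event of a frontier set is measurable. [folklore] -/
theorem measurableSet_frontierEvent (hS : IsFrontierSet M N S) (hM : 1 ≤ M) :
    MeasurableSet (frontierEvent M N S) :=
  (determinedBy_frontierEvent hS hM).measurableSet_of_finset

/-! ### Freshness: on the frontier event, "above" is read off `S` alone -/

/-- On `E_S` the above faces of the cluster configuration are the above faces of `↑S`. [folklore] -/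
theorem isAboveFace_clusterConfig_iff (hS : IsFrontierSet M N S) (hω : ω ∈ frontierEvent M N S) {f : Site 2} :
    IsAboveFace M N (clusterConfig M N ω S) f ↔ IsAboveFace M N (↑S : BondConfig (Site 2)) f :=
  ⟨fun hf => hS.isAboveFace_coe_of_isAboveFace ((hS.lowEdges_iff (hS.subset_clusterConfig hω.1)).1 hω.2) hf,
    fun hf => hf.mono (hS.subset_clusterConfig hω.1)⟩

/-- On `E_S` the low vertices of the cluster configuration are the vertices of `S`. [folklore] -/
theorem isLowVertex_clusterConfig_iff (hω : ω ∈ frontierEvent M N S) {p : Site 2} :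
    IsLowVertex M N (clusterConfig M N ω S) p ↔ p ∈ edgeVerts ↑S := by
  simp only [IsLowVertex, hω.2, mem_edgeVerts_coe_iff]

/-- The low vertices of `↑S` are the vertices of `S` (`S` a frontier set). [folklore] -/
theorem IsFrontierSet.isLowVertex_coe_iff (hS : IsFrontierSet M N S) {p : Site 2} :
    IsLowVertex M N (↑S : BondConfig (Site 2)) p ↔ p ∈ edgeVerts ↑S := by
  simp only [IsLowVertex, hS.1, mem_edgeVerts_coe_iff]

/-- **On `E_S` the above vertices of the cluster configuration are the above vertices of `↑S`.**
[folklore] -/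
theorem isAboveVertex_clusterConfig_iff (hS : IsFrontierSet M N S) (hω : ω ∈ frontierEvent M N S) {p : Site 2} :
    IsAboveVertex M N (clusterConfig M N ω S) p ↔ IsAboveVertex M N (↑S : BondConfig (Site 2)) p := by
  simp only [IsAboveVertex, isLowVertex_clusterConfig_iff hω, hS.isLowVertex_coe_iff,
    isAboveFace_clusterConfig_iff hS hω]

/-- **An edge at an above vertex of `↑S` is not a below pair** (no face around an above vertex is
flooded). [folklore] -/
theorem not_mem_belowPairs_of_isAboveVertex {p : Site 2} (hp : IsAboveVertex M N (↑S : BondConfig (Site 2)) p)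
    {e : Sym2 (Site 2)} (he : e ∈ (zdGraph 2).edgeSet) (hpe : p ∈ e) : e ∉ belowPairs M N S := by
  intro heB
  obtain ⟨g, hg, hge⟩ := mem_belowPairs_iff.1 heB
  exact hp.not_mem_of_cornerFaces (cornerFaces_of_mem_dualEdge he hpe (mem_dualEdge_of_mem_squareEdges hge)) hg

/-- **An edge at a vertex to the right of `R` is not a below pair** (the faces below lie in `R*`,
whose corners have `x₀ ≤ M`). [folklore] -/
theorem not_mem_belowPairs_of_lt_apply_zero {p : Site 2} (hp : (M : ℤ) < p 0) {e : Sym2 (Site 2)}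
    (he : e ∈ (zdGraph 2).edgeSet) (hpe : p ∈ e) : e ∉ belowPairs M N S := by
  intro heB
  obtain ⟨g, hg, hge⟩ := mem_belowPairs_iff.1 heB
  have hgc := mem_cornerFaces_iff.1 (cornerFaces_of_mem_dualEdge he hpe (mem_dualEdge_of_mem_squareEdges hge))
  have hgR := mem_dualRectangle_iff.1 (belowFaces_subset hg)
  omega

/-- **The open walk of `LowPath.exists_tipCatch` is fresh**: on `E_S`, an edge of the lattice at
a vertex which is to the right of `R` or an above vertex of the cluster configuration is not a
below pair of `S`. [folklore] -/
theorem not_mem_belowPairs_of_fresh (hS : IsFrontierSet M N S) (hω : ω ∈ frontierEvent M N S) {p : Site 2}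
    (hp : (M : ℤ) < p 0 ∨ IsAboveVertex M N (clusterConfig M N ω S) p) {e : Sym2 (Site 2)}
    (he : e ∈ (zdGraph 2).edgeSet) (hpe : p ∈ e) : e ∉ belowPairs M N S := by
  rcases hp with hp | hp
  · exact not_mem_belowPairs_of_lt_apply_zero hp he hpe
  · exact not_mem_belowPairs_of_isAboveVertex ((isAboveVertex_clusterConfig_iff hS hω).1 hp) he hpe

/-! ### The frontier event holds for the frontier of every crossing cluster -/

/-- **Two seeds of the same cluster give the same cluster configuration**: if the vertices of `T`
are pairwise joined in `(R, ω)` and the nonempty `S` lies in the cluster configuration of `T`, the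
cluster configurations of `S` and `T` coincide. [folklore] -/
theorem clusterConfig_eq_of_subset {T : Finset (Sym2 (Site 2))}
    (hT : ∀ y ∈ edgeVerts ↑T, ∀ y' ∈ edgeVerts ↑T, ∃ W : (zdGraph 2).Walk y y',
      (∀ z ∈ W.support, z ∈ rectangle M N) ∧ ∀ e ∈ W.edges, e ∈ ω)
    (hST : (↑S : Set (Sym2 (Site 2))) ⊆ clusterConfig M N ω T) (hSne : S.Nonempty) :
    clusterConfig M N ω S = clusterConfig M N ω T := by
  ext e
  constructor
  · rintro ⟨heω, heE, heR, x, hxe, y, ⟨s, hs, hys⟩, W, hWR, hWω⟩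
    obtain ⟨hsω, hsE, hsR, x', hx's, y', hy'T, W', hW'R, hW'ω⟩ := hST (Finset.mem_coe.2 hs)
    -- inside the edge `s`: from `x'` to `y`
    obtain ⟨U, hUR, hUω⟩ : ∃ U : (zdGraph 2).Walk x' y, (∀ z ∈ U.support, z ∈ rectangle M N) ∧
        ∀ e ∈ U.edges, e ∈ ω := by
      by_cases hxy : x' = y
      · subst hxy
        exact ⟨Walk.nil, fun z hz => by rw [Walk.support_nil, List.mem_singleton] at hz; rw [hz]; exact hsR _ hx's,
          fun e he => by simp at he⟩
      · have hs' : s = s(x', y) := (Sym2.mem_and_mem_iff hxy).1 ⟨hx's, hys⟩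
        have hadj : (zdGraph 2).Adj x' y := (SimpleGraph.mem_edgeSet _).1 (hs' ▸ hsE)
        refine ⟨Walk.cons hadj Walk.nil, fun z hz => ?_, fun e he => ?_⟩
        · rw [Walk.support_cons, Walk.support_nil, List.mem_cons, List.mem_singleton] at hz
          rcases hz with rfl | rfl
          · exact hsR _ hx's
          · exact hsR _ hys
        · rw [Walk.edges_cons, Walk.edges_nil, List.mem_singleton] at he
          rw [he, ← hs']; exact hsω
    refine ⟨heω, heE, heR, x, hxe, y', hy'T, W'.append (U.append W), fun z hz => ?_, fun e' he' => ?_⟩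
    · rw [Walk.mem_support_append_iff, Walk.mem_support_append_iff] at hz
      rcases hz with hz | hz | hz
      · exact hW'R z hz
      · exact hUR z hz
      · exact hWR z hz
    · rw [Walk.edges_append, List.mem_append, Walk.edges_append, List.mem_append] at he'
      rcases he' with he' | he' | he'
      · exact hW'ω e' he'
      · exact hUω e' he'
      · exact hWω e' he'
  · rintro ⟨heω, heE, heR, x, hxe, y', hy'T, W', hW'R, hW'ω⟩
    obtain ⟨s, hs⟩ := hSne
    obtain ⟨-, -, -, x', hx's, y'', hy''T, W'', hW''R, hW''ω⟩ := hST (Finset.mem_coe.2 hs)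
    obtain ⟨U, hUR, hUω⟩ := hT y'' hy''T y' hy'T
    refine ⟨heω, heE, heR, x, hxe, x', ⟨s, hs, hx's⟩, W''.reverse.append (U.append W'), fun z hz => ?_,
      fun e' he' => ?_⟩
    · rw [Walk.mem_support_append_iff, Walk.mem_support_append_iff, Walk.support_reverse, List.mem_reverse] at hz
      rcases hz with hz | hz | hz
      · exact hW''R z hz
      · exact hUR z hz
      · exact hW'R z hz
    · rw [Walk.edges_append, List.mem_append, Walk.edges_append, List.mem_append, Walk.edges_reverse,
        List.mem_reverse] at he'
      rcases he' with he' | he' | he'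
      · exact hW''ω e' he'
      · exact hUω e' he'
      · exact hW'ω e' he'

/-- **The frontier of a crossing cluster.**  Let `K` be a cluster configuration of `(R, ω)` for a
seed `T` whose vertices are pairwise joined in `(R, ω)` (e.g. the edges of an open walk), with an
open left–right crossing (no top face flooded for `K`), and let `Λ` be its lowest crossing.  Then
`S = Λ.edgeFinset` is a frontier set, `ω ∈ frontierEvent M N S`, and the cluster configuration
of `S` is `K`. [folklore] -/
theorem LowPath.mem_frontierEvent (hM : 1 ≤ M) {T : Finset (Sym2 (Site 2))}
    (hT : ∀ y ∈ edgeVerts ↑T, ∀ y' ∈ edgeVerts ↑T, ∃ W : (zdGraph 2).Walk y y',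
      (∀ z ∈ W.support, z ∈ rectangle M N) ∧ ∀ e ∈ W.edges, e ∈ ω)
    (Λ : LowPath M N (clusterConfig M N ω T))
    (hTK : ∀ t ∈ dualTopSide M N, t ∉ dualBelowR M N (clusterConfig M N ω T)) :
    IsFrontierSet M N Λ.edgeFinset ∧ ω ∈ frontierEvent M N Λ.edgeFinset ∧
      clusterConfig M N ω Λ.edgeFinset = clusterConfig M N ω T := by
  have hS := Λ.isFrontierSet_edgeFinset clusterConfig_subset_edgeSet hTK
  have hSK : (↑Λ.edgeFinset : Set (Sym2 (Site 2))) ⊆ clusterConfig M N ω T :=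
    Λ.coe_edgeFinset_subset clusterConfig_subset_edgeSet
  have heq := clusterConfig_eq_of_subset hT hSK (Λ.edgeFinset_nonempty hM)
  refine ⟨hS, ⟨fun e he => clusterConfig_subset (hSK he), fun e => ?_⟩, heq⟩
  rw [heq, Λ.mem_edgeFinset_iff]
  exact (Λ.mem_edges_iff e).symm

end Literature.Probability.Percolation

end
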